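import Mathlib.RingTheory.Algebraic.Basic
import Literature.NumberTheory.Transcendental.KZCalculus
import Literature.NumberTheory.Transcendental.SemialgebraicMapsProofs
import Literature.NumberTheory.Transcendental.KZSemialgebraicComplex
import Literature.NumberTheory.Transcendental.SemialgebraicLineDeriv
import Literature.NumberTheory.Transcendental.SemialgebraicAlgebraicPoints
import Literature.NumberTheory.Transcendental.KZIntervalPeriodProofs

/-!
# `BetaCancellation` (stmt-KontsevichZagierPeriods-13633), line `dirichlet-companion-to-pi` — stub `stub_catalyticNewtonLeibniz`

**Catalytic Newton–Leibniz moves descend.** Let `p = [K, f]` be a catalyst of dimension `d`, and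
let `q = p ⊗ s` (dimension `d + n + 1`) and `q' = p ⊗ s'` (dimension `d + n`) be the pinned
products in the crux coordinates (`head z = fun i => z (Fin.castAdd _ i)`,
`tail z = fun j => z (Fin.natAdd d j)`; domain `{z | head z ∈ K ∧ tail z ∈ σ}`, integrand
`f (head z) * g (tail z)`). Suppose `[q] − [q']` is ONE Newton–Leibniz move along the last
coordinate: `q.domain` is the band over `q'.domain` between `ℚ`-semialgebraic edges `a ≤ b`, with a
`ℚ`-semialgebraic primitive `F` on the band, fibrewise continuous on `[a x, b x]`, with derivative
`q.integrand` on `(a x, b x)` and boundary values `q'.integrand x = F (x, b x) − F (x, a x)`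
(hypotheses verbatim those of `KZ.newtonLeibnizRel`). If `x₀ ∈ K` has algebraic coordinates and
`c₀ = f x₀ ≠ 0`, then `s ∼ s'`.

Proof. Slice everything at the catalyst point `x₀` and divide by the algebraic constant `c₀`
(`IsSemialgebraicFunOn.isAlgebraic_apply`): with `X w = Fin.append x₀ w ∈ ℝ^{d+n}` and the band
point `Fin.snoc (X w) t ∈ ℝ^{d+n+1}` (whose head is `x₀` and whose tail is `Fin.snoc w t`), put
`a₀ w = a (X w)`, `b₀ w = b (X w)`, `G v = c₀⁻¹ · F (Fin.snoc (X (Fin.init v)) (v (Fin.last n)))`.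
The slice maps are `ℚ`-semialgebraic (coordinates are algebraic constants or coordinate functions,
`IsSemialgebraicMapOn.of_forall`), so `a₀`, `b₀`, `G` are `ℚ`-semialgebraic
(`IsSemialgebraicFunOn.comp_isSemialgebraicMapOn_holds`, Bochnak–Coste–Roy Prop. 2.2.6);
`s.domain` is the band over `s'.domain` between `a₀ ≤ b₀` (read off `hdom` at the points
`Fin.snoc (X (Fin.init v)) (v (Fin.last n))`); on the fibre over `w ∈ s'.domain`,
`t ↦ G (Fin.snoc w t) = c₀⁻¹ F (Fin.snoc (X w) t)` is continuous on `[a₀ w, b₀ w]` with derivative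
`c₀⁻¹ · q.integrand (Fin.snoc (X w) t) = c₀⁻¹ c₀ · s.integrand (Fin.snoc w t)` on the open fibre
(`HasDerivAt.const_mul`), and `s'.integrand w = c₀⁻¹ q'.integrand (X w) = G (w, b₀ w) − G (w, a₀ w)`.
Hence `[s] − [s'] ∈ newtonLeibnizRel ⊆ relations`. No definitions; sorry-free;
axioms ⊆ {propext, Classical.choice, Quot.sound}.

References: M. Kontsevich, D. Zagier, *Periods* (2001), §1.2 rule (3); J. Bochnak, M. Coste,
M.-F. Roy, *Real Algebraic Geometry* (1998), Prop. 2.2.6.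
-/

noncomputable section

-- `Summit.KontsevichZagierPeriods.KontsevichZagierPeriods.…` is the tree's mandated layout (single-conjunct summit).
set_option linter.dupNamespace false

namespace Summit.KontsevichZagierPeriods.KontsevichZagierPeriods.BetaCancellationLine

open Set
open Literature.NumberTheory.Transcendental
open Literature.NumberTheory.Transcendental.KZ

/-! ### Index bookkeeping: head and tail of a band point over a sliced base point -/

/-- The head (first `d` coordinates) of the band point `Fin.snoc (Fin.append x₀ w) t ∈ ℝ^{d+n+1}`
is `x₀`. [folklore] -/
theorem catalyticNL_snoc_append_castAdd {d n : ℕ} (x₀ : Fin d → ℝ) (w : Fin n → ℝ) (t : ℝ)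
    (i : Fin d) :
    (Fin.snoc (Fin.append x₀ w) t : Fin (d + n + 1) → ℝ) (Fin.castAdd (n + 1) i) = x₀ i := by
  rw [Fin.snoc_castAdd (α := fun _ => ℝ) (Fin.append x₀ w) t i, Fin.append_left]

/-- The tail (last `n + 1` coordinates) of the band point `Fin.snoc (Fin.append x₀ w) t ∈ ℝ^{d+n+1}`
is `Fin.snoc w t`. [folklore] -/
theorem catalyticNL_snoc_append_natAdd {d n : ℕ} (x₀ : Fin d → ℝ) (w : Fin n → ℝ) (t : ℝ)
    (j : Fin (n + 1)) :
    (Fin.snoc (Fin.append x₀ w) t : Fin (d + n + 1) → ℝ) (Fin.natAdd d j) =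
      (Fin.snoc w t : Fin (n + 1) → ℝ) j := by
  refine Fin.lastCases ?_ (fun j' => ?_) j
  · rw [Fin.natAdd_last, Fin.snoc_last, Fin.snoc_last]
  · rw [Fin.natAdd_castSucc, Fin.snoc_castSucc, Fin.snoc_castSucc, Fin.append_right]

/-! ### Membership and integrands of pinned products at sliced points -/

/-- A sliced base point `Fin.append x₀ w` lies in the pinned product domain
`{z | head z ∈ K ∧ tail z ∈ σ}` iff `x₀ ∈ K` and `w ∈ σ`. [folklore] -/
theorem catalyticNL_append_mem_prod {d n : ℕ} {K : Set (Fin d → ℝ)} {σ : Set (Fin n → ℝ)}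
    {S : Set (Fin (d + n) → ℝ)}
    (hS : S = {z | (fun i => z (Fin.castAdd n i)) ∈ K ∧ (fun j => z (Fin.natAdd d j)) ∈ σ})
    (x₀ : Fin d → ℝ) (w : Fin n → ℝ) :
    Fin.append x₀ w ∈ S ↔ x₀ ∈ K ∧ w ∈ σ := by
  rw [hS, mem_setOf_eq]
  simp only [Fin.append_left, Fin.append_right]

/-- A band point `Fin.snoc (Fin.append x₀ w) t` lies in the pinned product domain
`{z | head z ∈ K ∧ tail z ∈ σ}` (dimension `d + n + 1`) iff `x₀ ∈ K` and `Fin.snoc w t ∈ σ`.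
[folklore] -/
theorem catalyticNL_snoc_mem_prod {d n : ℕ} {K : Set (Fin d → ℝ)} {σ : Set (Fin (n + 1) → ℝ)}
    {S : Set (Fin (d + n + 1) → ℝ)}
    (hS : S = {z | (fun i => z (Fin.castAdd (n + 1) i)) ∈ K ∧ (fun j => z (Fin.natAdd d j)) ∈ σ})
    (x₀ : Fin d → ℝ) (w : Fin n → ℝ) (t : ℝ) :
    (Fin.snoc (Fin.append x₀ w) t : Fin (d + n + 1) → ℝ) ∈ S ↔ x₀ ∈ K ∧ Fin.snoc w t ∈ σ := by
  rw [hS, mem_setOf_eq]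
  simp only [catalyticNL_snoc_append_castAdd, catalyticNL_snoc_append_natAdd]

/-- At a sliced base point of its domain, a pinned product integrand `f (head z) * g (tail z)`
takes the value `f x₀ * g w`. [folklore] -/
theorem catalyticNL_append_integrand_prod {d n : ℕ} {S : Set (Fin (d + n) → ℝ)}
    {φ : (Fin (d + n) → ℝ) → ℝ} {f : (Fin d → ℝ) → ℝ} {g : (Fin n → ℝ) → ℝ}
    (hφ : EqOn φ (fun z => f (fun i => z (Fin.castAdd n i)) * g (fun j => z (Fin.natAdd d j))) S)
    {x₀ : Fin d → ℝ} {w : Fin n → ℝ} (hz : Fin.append x₀ w ∈ S) :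
    φ (Fin.append x₀ w) = f x₀ * g w := by
  rw [hφ hz]
  simp only [Fin.append_left, Fin.append_right]

/-- At a band point of its domain, a pinned product integrand `f (head z) * g (tail z)`
(dimension `d + n + 1`) takes the value `f x₀ * g (Fin.snoc w t)`. [folklore] -/
theorem catalyticNL_snoc_integrand_prod {d n : ℕ} {S : Set (Fin (d + n + 1) → ℝ)}
    {φ : (Fin (d + n + 1) → ℝ) → ℝ} {f : (Fin d → ℝ) → ℝ} {g : (Fin (n + 1) → ℝ) → ℝ}
    (hφ : EqOn φ (fun z => f (fun i => z (Fin.castAdd (n + 1) i)) *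
      g (fun j => z (Fin.natAdd d j))) S)
    {x₀ : Fin d → ℝ} {w : Fin n → ℝ} {t : ℝ}
    (hz : (Fin.snoc (Fin.append x₀ w) t : Fin (d + n + 1) → ℝ) ∈ S) :
    φ (Fin.snoc (Fin.append x₀ w) t) = f x₀ * g (Fin.snoc w t) := by
  rw [hφ hz]
  simp only [catalyticNL_snoc_append_castAdd, catalyticNL_snoc_append_natAdd]

/-! ### The slice maps are `ℚ`-semialgebraic -/

/-- The base slice map `w ↦ Fin.append x₀ w` at a point `x₀` with algebraic coordinates is a
`ℚ`-semialgebraic map on every `ℚ`-semialgebraic set: its coordinates are algebraic constants or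
coordinate functions. [cite: BochnakCosteRoy1998, Prop. 2.2.6] -/
theorem catalyticNL_sliceMap {d m : ℕ} {x₀ : Fin d → ℝ} (halg : ∀ i, IsAlgebraic ℚ (x₀ i))
    {σ : Set (Fin m → ℝ)} (hσ : Literature.ModelTheory.ExponentialFields.IsSemialgebraic ℚ σ) :
    IsSemialgebraicMapOn ℚ σ (fun w => Fin.append x₀ w) := by
  refine IsSemialgebraicMapOn.of_forall hσ fun k => ?_
  refine Fin.addCases (fun i => ?_) (fun j => ?_) k
  · simp only [Fin.append_left]
    exact isSemialgebraicFunOn_const_of_isAlgebraic hσ (halg i)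
  · simp only [Fin.append_right]
    exact isSemialgebraicFunOn_apply hσ j

/-- The band slice map `v ↦ Fin.snoc (Fin.append x₀ (Fin.init v)) (v (Fin.last n))` (insert the
algebraic point `x₀` in front of `v ∈ ℝ^{n+1}`) is a `ℚ`-semialgebraic map on every
`ℚ`-semialgebraic set: its coordinates are algebraic constants or coordinate functions.
[cite: BochnakCosteRoy1998, Prop. 2.2.6] -/
theorem catalyticNL_bandSliceMap {d n : ℕ} {x₀ : Fin d → ℝ} (halg : ∀ i, IsAlgebraic ℚ (x₀ i))
    {σ : Set (Fin (n + 1) → ℝ)} (hσ : Literature.ModelTheory.ExponentialFields.IsSemialgebraic ℚ σ) :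
    IsSemialgebraicMapOn ℚ σ (fun v : Fin (n + 1) → ℝ =>
      (Fin.snoc (Fin.append x₀ (Fin.init v)) (v (Fin.last n)) : Fin (d + n + 1) → ℝ)) := by
  refine IsSemialgebraicMapOn.of_forall hσ fun k => ?_
  refine Fin.lastCases ?_ (fun k' => ?_) k
  · simp only [Fin.snoc_last]
    exact isSemialgebraicFunOn_apply hσ (Fin.last n)
  · simp only [Fin.snoc_castSucc]
    refine Fin.addCases (fun i => ?_) (fun j => ?_) k'
    · simp only [Fin.append_left]
      exact isSemialgebraicFunOn_const_of_isAlgebraic hσ (halg i)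
    · simp only [Fin.append_right]
      exact isSemialgebraicFunOn_apply hσ (Fin.castSucc j)

/-! ### The stub -/

/-- **Catalytic Newton–Leibniz moves descend** (seat c14, cycle 2). Let `q = p ⊗ s` (dimension
`d + n + 1`) and `q' = p ⊗ s'` (dimension `d + n`) be pinned products over a catalyst `p` (crux
coordinates), related by ONE Newton–Leibniz move along the last coordinate with edges `a ≤ b` and
primitive `F` (hypotheses verbatim those of `KZ.newtonLeibnizRel`), and let `x₀ ∈ p.domain` have
algebraic coordinates and `p.integrand x₀ ≠ 0`. Then `s ∼ s'`: the sliced, rescaled primitive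
`G v = (p.integrand x₀)⁻¹ · F (Fin.snoc (Fin.append x₀ (Fin.init v)) (v (Fin.last n)))` with edges
`a (Fin.append x₀ ·)`, `b (Fin.append x₀ ·)` witnesses `[s] − [s'] ∈ newtonLeibnizRel` (the band of
`s` over `s'.domain` is read off `hdom` at the sliced band points; slices at an algebraic point and
the algebraic constant `(p.integrand x₀)⁻¹` are `ℚ`-semialgebraic).
[cite: KontsevichZagier2001, §1.2 rule (3)] -/
theorem stub_catalyticNewtonLeibniz {d n : ℕ} (p : IntegralRep d) (x₀ : Fin d → ℝ)
    (hx₀ : x₀ ∈ p.domain) (halg : ∀ i, IsAlgebraic ℚ (x₀ i)) (hpx₀ : p.integrand x₀ ≠ 0)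
    (s : IntegralRep (n + 1)) (s' : IntegralRep n) (q : IntegralRep (d + n + 1))
    (q' : IntegralRep (d + n))
    (hq : q.domain = {z | (fun i => z (Fin.castAdd (n + 1) i)) ∈ p.domain ∧
      (fun j => z (Fin.natAdd d j)) ∈ s.domain})
    (hqi : Set.EqOn q.integrand (fun z => p.integrand (fun i => z (Fin.castAdd (n + 1) i)) *
      s.integrand (fun j => z (Fin.natAdd d j))) q.domain)
    (hq' : q'.domain = {z | (fun i => z (Fin.castAdd n i)) ∈ p.domain ∧
      (fun j => z (Fin.natAdd d j)) ∈ s'.domain})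
    (hq'i : Set.EqOn q'.integrand (fun z => p.integrand (fun i => z (Fin.castAdd n i)) *
      s'.integrand (fun j => z (Fin.natAdd d j))) q'.domain)
    (a b : (Fin (d + n) → ℝ) → ℝ) (F : (Fin (d + n + 1) → ℝ) → ℝ)
    (hF : IsSemialgebraicFunOn ℚ q.domain F)
    (ha : IsSemialgebraicFunOn ℚ q'.domain a) (hb : IsSemialgebraicFunOn ℚ q'.domain b)
    (hab : ∀ x ∈ q'.domain, a x ≤ b x)
    (hdom : q.domain = {z | (Fin.init z : Fin (d + n) → ℝ) ∈ q'.domain ∧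
      a (Fin.init z) ≤ z (Fin.last (d + n)) ∧ z (Fin.last (d + n)) ≤ b (Fin.init z)})
    (hcont : ∀ x ∈ q'.domain, ContinuousOn (fun t : ℝ => F (Fin.snoc x t)) (Set.Icc (a x) (b x)))
    (hderiv : ∀ x ∈ q'.domain, ∀ t ∈ Set.Ioo (a x) (b x),
      HasDerivAt (fun u : ℝ => F (Fin.snoc x u)) (q.integrand (Fin.snoc x t)) t)
    (hval : ∀ x ∈ q'.domain, q'.integrand x = F (Fin.snoc x (b x)) - F (Fin.snoc x (a x))) :
    Equivalent s s' := by
  -- the algebraic constant `c₀⁻¹ = (p.integrand x₀)⁻¹`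
  have hcinv : IsAlgebraic ℚ (p.integrand x₀)⁻¹ :=
    (p.isSemialgebraicFunOn_integrand.isAlgebraic_apply hx₀ halg).inv
  -- sliced base points `X w = Fin.append x₀ w` and band points `Fin.snoc (X (init v)) (v last)`
  have hXmem : ∀ w : Fin n → ℝ, Fin.append x₀ w ∈ q'.domain ↔ w ∈ s'.domain := fun w => by
    rw [catalyticNL_append_mem_prod hq' x₀ w, and_iff_right hx₀]
  have hZmem : ∀ v : Fin (n + 1) → ℝ,
      (Fin.snoc (Fin.append x₀ (Fin.init v)) (v (Fin.last n)) : Fin (d + n + 1) → ℝ) ∈ q.domain ↔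
        v ∈ s.domain := fun v => by
    rw [catalyticNL_snoc_mem_prod hq x₀ (Fin.init v) (v (Fin.last n)), and_iff_right hx₀,
      Fin.snoc_init_self]
  have hZband : ∀ v : Fin (n + 1) → ℝ,
      (Fin.snoc (Fin.append x₀ (Fin.init v)) (v (Fin.last n)) : Fin (d + n + 1) → ℝ) ∈ q.domain ↔
        (Fin.init v : Fin n → ℝ) ∈ s'.domain ∧ a (Fin.append x₀ (Fin.init v)) ≤ v (Fin.last n) ∧
          v (Fin.last n) ≤ b (Fin.append x₀ (Fin.init v)) := fun v => by
    rw [hdom, mem_setOf_eq, Fin.init_snoc, Fin.snoc_last, hXmem]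
  -- (3) the band of `s` over `s'.domain`
  have hband : s.domain = {v | (Fin.init v : Fin n → ℝ) ∈ s'.domain ∧
      a (Fin.append x₀ (Fin.init v)) ≤ v (Fin.last n) ∧
        v (Fin.last n) ≤ b (Fin.append x₀ (Fin.init v))} := by
    ext v
    rw [mem_setOf_eq, ← hZband, hZmem]
  have hXq' : ∀ w ∈ s'.domain, Fin.append x₀ w ∈ q'.domain := fun w hw => (hXmem w).2 hw
  -- band points over `X w`, `w ∈ s'.domain`, lie in `q.domain`
  have hsnocq : ∀ w ∈ s'.domain, ∀ t : ℝ, a (Fin.append x₀ w) ≤ t → t ≤ b (Fin.append x₀ w) →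
      (Fin.snoc (Fin.append x₀ w) t : Fin (d + n + 1) → ℝ) ∈ q.domain := by
    intro w hw t h₁ h₂
    rw [hdom, mem_setOf_eq, Fin.init_snoc, Fin.snoc_last]
    exact ⟨hXq' w hw, h₁, h₂⟩
  -- the two product integrands at sliced points: the catalyst contributes the constant `c₀`
  have hq'X : ∀ w ∈ s'.domain, q'.integrand (Fin.append x₀ w) = p.integrand x₀ * s'.integrand w :=
    fun w hw => catalyticNL_append_integrand_prod hq'i (hXq' w hw)
  have hqZ : ∀ w ∈ s'.domain, ∀ t : ℝ, a (Fin.append x₀ w) ≤ t → t ≤ b (Fin.append x₀ w) →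
      q.integrand (Fin.snoc (Fin.append x₀ w) t) = p.integrand x₀ * s.integrand (Fin.snoc w t) :=
    fun w hw t h₁ h₂ => catalyticNL_snoc_integrand_prod hqi (hsnocq w hw t h₁ h₂)
  -- (1) semialgebraicity of the sliced edges and of the sliced, rescaled primitive
  have ha₀ : IsSemialgebraicFunOn ℚ s'.domain (fun w => a (Fin.append x₀ w)) :=
    IsSemialgebraicFunOn.comp_isSemialgebraicMapOn_holds ha
      (catalyticNL_sliceMap halg s'.isSemialgebraic_domain) hXq'
  have hb₀ : IsSemialgebraicFunOn ℚ s'.domain (fun w => b (Fin.append x₀ w)) :=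
    IsSemialgebraicFunOn.comp_isSemialgebraicMapOn_holds hb
      (catalyticNL_sliceMap halg s'.isSemialgebraic_domain) hXq'
  have hG : IsSemialgebraicFunOn ℚ s.domain (fun v => (p.integrand x₀)⁻¹ *
      F (Fin.snoc (Fin.append x₀ (Fin.init v)) (v (Fin.last n)))) :=
    (isSemialgebraicFunOn_const_of_isAlgebraic s.isSemialgebraic_domain hcinv).fun_mul
      (IsSemialgebraicFunOn.comp_isSemialgebraicMapOn_holds hF
        (catalyticNL_bandSliceMap halg s.isSemialgebraic_domain) fun v hv => (hZmem v).2 hv)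
  -- (7) one Newton–Leibniz move `[s] − [s']`
  refine newtonLeibnizRel_subset_relations ⟨n, s, s', fun w => a (Fin.append x₀ w),
    fun w => b (Fin.append x₀ w),
    fun v => (p.integrand x₀)⁻¹ * F (Fin.snoc (Fin.append x₀ (Fin.init v)) (v (Fin.last n))),
    hG, ha₀, hb₀, fun w hw => hab _ (hXq' w hw), hband, ?_, ?_, ?_, rfl⟩
  · -- (4) fibrewise continuity on the closed fibre
    intro w hw
    simp only [Fin.init_snoc, Fin.snoc_last]
    exact continuousOn_const.mul (hcont _ (hXq' w hw))
  · -- (5) fibrewise derivative on the open fibre: `c₀⁻¹ · (c₀ · s.integrand) = s.integrand`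
    intro w hw t ht
    simp only [Fin.init_snoc, Fin.snoc_last]
    have h := (hderiv _ (hXq' w hw) t ht).const_mul (p.integrand x₀)⁻¹
    rw [hqZ w hw t ht.1.le ht.2.le, ← mul_assoc, inv_mul_cancel₀ hpx₀, one_mul] at h
    exact h
  · -- (6) boundary values
    intro w hw
    simp only [Fin.init_snoc, Fin.snoc_last]
    rw [← mul_sub, ← hval _ (hXq' w hw), hq'X w hw, ← mul_assoc, inv_mul_cancel₀ hpx₀, one_mul]

end Summit.KontsevichZagierPeriods.KontsevichZagierPeriods.BetaCancellationLine

end
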